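import Mathlib
import HarnessLib
import Summits.Ventures.LatticeQCDFlow.Exactness.FlowSamplerTranslationCovariance
import Summits.Ventures.LatticeQCDFlow.Exactness.SUNStoutLayerChargeConjugation
import Summits.Ventures.LatticeQCDFlow.Exactness.EngineHMCChargeConjugation

/-!
# The `SU(N)` flow sampler commutes with CHARGE CONJUGATION when its flow does: from the hot start `E_t[Im tr W] = 0` for every conjugation-equivariant loop `W` at EVERY step — a free exactness null test out of equilibrium

HONEST FRAMING: exact (Metropolis-corrected) sampling algorithms for lattice gauge theory;
figures of merit are autocorrelation/cost numbers at stated couplings and volumes; no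
continuum-physics claim.

Venture `LatticeQCDFlow` (cell pub-lqcd), topic `Exactness`; FANOUT row 10 (`eng-equiv`, engine
`latflow.equiv` / `latflow.flows_jax`: flow sampler `equiv/imh.py` / `make_proposer`; per-record
observables `extra_obs` of the chains it writes).  NEW WORK of the cell; nothing is cited as a fact;
no number; no definition is introduced.  Composition of three tree facts: §1 of
`FlowSamplerTranslationCovariance` (`conjKernel_flowSampler_eq_self`: the independence-Metropolis
kernel commutes with every symmetry of its data), `SUNStoutLayerChargeConjugation` (the masked stout
layer intertwines `configConj`, its continuous exact Jacobians are conjugation invariant) and rows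
16 / 21's charge-conjugation toolkit (`configConj`, `measurePreserving_configAut_piHaar`,
`wilsonAction_configAut`, `integral_im_trace_eq_zero_of_map_configConj`: under a conjugation-invariant
law every `W` with `W(Ū) = conj W(U)` has `E[Im tr W] = 0`).  Rows 16 / 21 typed the statement for
the HMC arms (`Scoring.HMCKernelChargeConjugation`, `EngineHMCChargeConjugation`); this is the flow
sampler's.

## What is typed (every `N`, `d`, `L ≥ 1`)

* **`conjKernel_flowSampler_configConj`** — `Ψ : SU(N)^E ≃ᵐ SU(N)^E` with `Ψ(V̄) = conj Ψ(V)`,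
  conjugation-invariant measurable target weight `g` and Jacobian `J`:
  `conjKernel (indepMH (Ψ_* Haar^⊗) (g·(J∘Ψ⁻¹))) (configConj N) = indepMH …`;
* **`conjKernel_wilsonFlowSampler_configConj`** — Wilson target for any continuous representation
  with `Re tr ρ(ḡ) = Re tr ρ(g)` (the fundamental one: `re_trace_fundamentalRep_suConjAut`),
  CONTINUOUS exact Jacobian: the only hypothesis left is `Ψ(V̄) = conj Ψ(V)`
  (`chargeConjInvariant_jacobian_of_comm`);
* out of equilibrium: `flowModel_map_configConj`, **`wilsonFlowSampler_law_map_configConj`** — from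
  any conjugation-invariant start (hot `piHaar_map_configConj`, cold `dirac_one_map_configConj`, the
  model law) the law of the run is conjugation invariant at every step — and
  **`integral_wilsonFlowSampler_im_trace_eq_zero`**: `E_t[Im tr W(U)] = 0` at EVERY step `t` for
  every conjugation-equivariant `SU(N)`-valued field function `W` (links, plaquettes, straight /
  Polyakov lines: `plaquetteHolonomy_configConj`, `lineHolonomy_configConj`) — so a flow-sampler
  chain whose running mean of `Im tr U_P` drifts from `0` beyond errors indicts the implementation,
  thermalised or not;
* the `SU(N)` STOUT flow sampler of `SUNStoutFlowSamplerErgodic` with a conjugation-even coefficient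
  field: **`conjKernel_stoutFlowSampler_configConj`**, `stoutFlowSampler_hotStart_law_map_configConj`,
  **`integral_stoutFlowSampler_hotStart_im_trace_plaquette_eq_zero`**,
  `integral_stoutFlowSampler_hotStart_im_trace_lineHolonomy_eq_zero`, and from the Wilson measure at
  ANY coupling `β₀` (the engine's `β`-bootstrapping start; `wilsonMeasure_map_configAut`):
  `integral_stoutFlowSampler_wilsonStart_im_trace_plaquette_eq_zero`.

NOT here: `Re tr` (centre symmetry — even under conjugation); the `U(1)` / spectral flows (their
kernels commute with conjugation only under an oddness constraint the engine does not impose); numbers.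
-/

noncomputable section

namespace Summit.Ventures.LatticeQCDFlow.Exactness

open MeasureTheory ProbabilityTheory ProbabilityTheory.Kernel Set
open Literature.MathematicalPhysics.QuantumFieldTheory
open Literature.MathematicalPhysics.QuantumFieldTheory.Luscher2010
open Literature.MathematicalPhysics.QuantumLattice (fundamentalRep)
open scoped ENNReal Matrix

variable {d L n : ℕ} [NeZero L]

/-! ## §1 A conjugation-equivariant flow gives a conjugation-symmetric flow sampler -/

/-- **The model law `Ψ_* Haar^⊗` of a conjugation-equivariant flow is conjugation invariant.** -/
theorem flowModel_map_configConj
    {Ψ : GaugeConfig d L (Matrix.specialUnitaryGroup (Fin n) ℂ) → GaugeConfig d L (Matrix.specialUnitaryGroup (Fin n) ℂ)}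
    (hΨm : Measurable Ψ) (hΨ : ∀ V, Ψ (configConj n V) = configConj n (Ψ V)) :
    ((Measure.pi fun _ : Edge d L => haarProbability (Matrix.specialUnitaryGroup (Fin n) ℂ)).map Ψ).map (configConj n) =
      (Measure.pi fun _ : Edge d L => haarProbability (Matrix.specialUnitaryGroup (Fin n) ℂ)).map Ψ :=
  map_map_eq_self_of_comm hΨm (configConj n)
    (measurePreserving_configAut_piHaar (d := d) (L := L) (suConjAut n)).map_eq hΨ

/-- **A conjugation-equivariant flow gives a conjugation-symmetric flow sampler** (conjugation-invariant
measurable target weight `g` and Jacobian `J`). -/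
theorem conjKernel_flowSampler_configConj
    (Ψ : GaugeConfig d L (Matrix.specialUnitaryGroup (Fin n) ℂ) ≃ᵐ GaugeConfig d L (Matrix.specialUnitaryGroup (Fin n) ℂ))
    (hΨ : ∀ V, Ψ (configConj n V) = configConj n (Ψ V))
    {g J : GaugeConfig d L (Matrix.specialUnitaryGroup (Fin n) ℂ) → ℝ} (hgm : Measurable g) (hJm : Measurable J)
    (hg : ∀ V, g (configConj n V) = g V) (hJ : ∀ V, J (configConj n V) = J V) :
    haveI : IsProbabilityMeasure
        ((Measure.pi fun _ : Edge d L => haarProbability (Matrix.specialUnitaryGroup (Fin n) ℂ)).map Ψ) :=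
      Measure.isProbabilityMeasure_map Ψ.measurable.aemeasurable
    conjKernel (indepMH ((Measure.pi fun _ : Edge d L =>
          haarProbability (Matrix.specialUnitaryGroup (Fin n) ℂ)).map Ψ) (fun U => g U * J (Ψ.symm U))) (configConj n) =
      indepMH ((Measure.pi fun _ : Edge d L =>
          haarProbability (Matrix.specialUnitaryGroup (Fin n) ℂ)).map Ψ) (fun U => g U * J (Ψ.symm U)) :=
  conjKernel_flowSampler_eq_self Ψ (configConj n) hgm hJm
    (measurePreserving_configAut_piHaar (d := d) (L := L) (suConjAut n)) hΨ hg hJ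

/-- **A continuous exact Jacobian of a conjugation-equivariant automorphism of `SU(N)^E` is conjugation
invariant** (`HasJacobian.jac_comp_symm_eq` with `T = configConj N`). -/
theorem chargeConjInvariant_jacobian_of_comm
    (Ψ : GaugeConfig d L (Matrix.specialUnitaryGroup (Fin n) ℂ) ≃ᵐ GaugeConfig d L (Matrix.specialUnitaryGroup (Fin n) ℂ))
    (hΨ : ∀ V, Ψ (configConj n V) = configConj n (Ψ V))
    {j : GaugeConfig d L (Matrix.specialUnitaryGroup (Fin n) ℂ) → ℝ} (hj : Continuous j) (hj0 : ∀ U, 0 ≤ j U)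
    (h : HasJacobian (Measure.pi fun _ : Edge d L => haarProbability (Matrix.specialUnitaryGroup (Fin n) ℂ)) Ψ
      (fun U => ENNReal.ofReal (j U)))
    (U : GaugeConfig d L (Matrix.specialUnitaryGroup (Fin n) ℂ)) : j (configConj n U) = j U := by
  haveI : SecondCountableTopology (Matrix (Fin n) (Fin n) ℂ) :=
    inferInstanceAs (SecondCountableTopology (Fin n → Fin n → ℂ))
  haveI : SecondCountableTopology (Matrix.specialUnitaryGroup (Fin n) ℂ) :=
    Topology.IsEmbedding.subtypeVal.secondCountableTopology
  haveI : (haarProbability (Matrix.specialUnitaryGroup (Fin n) ℂ)).IsOpenPosMeasure := by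
    unfold haarProbability; infer_instance
  have hTc : Continuous (configConj (d := d) (L := L) n) :=
    continuous_pi fun e => (suConjAut n).continuous.comp (continuous_apply e)
  have h1 := HasJacobian.jac_comp_symm_eq hj h (configConj n)
    (measurePreserving_configAut_piHaar (d := d) (L := L) (suConjAut n)) hTc hΨ U
  exact (ENNReal.ofReal_eq_ofReal_iff (hj0 _) (hj0 _)).1 h1

/-- **The WILSON flow sampler of a conjugation-equivariant flow with a continuous exact Jacobian is
conjugation symmetric** — any continuous representation with `Re tr ρ(ḡ) = Re tr ρ(g)`; the weight
hypotheses are DISCHARGED (`wilsonAction_configAut`, `chargeConjInvariant_jacobian_of_comm`). -/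
theorem conjKernel_wilsonFlowSampler_configConj {N : ℕ}
    (ρ : Matrix.specialUnitaryGroup (Fin n) ℂ →* Matrix (Fin N) (Fin N) ℂ) (hρ : Continuous ρ)
    (hρC : ∀ g, (ρ (suConjAut n g)).trace.re = (ρ g).trace.re) (β : ℝ)
    (Ψ : GaugeConfig d L (Matrix.specialUnitaryGroup (Fin n) ℂ) ≃ᵐ GaugeConfig d L (Matrix.specialUnitaryGroup (Fin n) ℂ))
    (hΨ : ∀ V, Ψ (configConj n V) = configConj n (Ψ V))
    {J : GaugeConfig d L (Matrix.specialUnitaryGroup (Fin n) ℂ) → ℝ} (hJc : Continuous J) (hJ0 : ∀ U, 0 ≤ J U)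
    (hJac : HasJacobian (Measure.pi fun _ : Edge d L => haarProbability (Matrix.specialUnitaryGroup (Fin n) ℂ)) Ψ
      (fun U => ENNReal.ofReal (J U))) :
    haveI : IsProbabilityMeasure
        ((Measure.pi fun _ : Edge d L => haarProbability (Matrix.specialUnitaryGroup (Fin n) ℂ)).map Ψ) :=
      Measure.isProbabilityMeasure_map Ψ.measurable.aemeasurable
    conjKernel (indepMH ((Measure.pi fun _ : Edge d L =>
          haarProbability (Matrix.specialUnitaryGroup (Fin n) ℂ)).map Ψ)
        (fun U => Real.exp (-β * wilsonAction ρ U) * J (Ψ.symm U))) (configConj n) =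
      indepMH ((Measure.pi fun _ : Edge d L =>
          haarProbability (Matrix.specialUnitaryGroup (Fin n) ℂ)).map Ψ)
        (fun U => Real.exp (-β * wilsonAction ρ U) * J (Ψ.symm U)) := by
  obtain ⟨_, -, -, hgm⟩ := wilsonBoltzmann_pinched (d := d) (L := L) ρ hρ β
  refine conjKernel_flowSampler_configConj Ψ hΨ hgm hJc.measurable (fun V => ?_)
    (chargeConjInvariant_jacobian_of_comm Ψ hΨ hJc hJ0 hJac)
  rw [wilsonAction_configAut hρC]

/-! ## §2 Out of equilibrium: conjugation-invariant laws; `E_t[Im tr W] = 0` at every step -/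

/-- **At every step the law of the Wilson flow-sampler run from a conjugation-invariant start is
conjugation invariant** (starts: `Scoring.piHaar_map_configConj`, `Scoring.dirac_one_map_configConj`,
`flowModel_map_configConj`). -/
theorem wilsonFlowSampler_law_map_configConj {N : ℕ}
    (ρ : Matrix.specialUnitaryGroup (Fin n) ℂ →* Matrix (Fin N) (Fin N) ℂ) (hρ : Continuous ρ)
    (hρC : ∀ g, (ρ (suConjAut n g)).trace.re = (ρ g).trace.re) (β : ℝ)
    (Ψ : GaugeConfig d L (Matrix.specialUnitaryGroup (Fin n) ℂ) ≃ᵐ GaugeConfig d L (Matrix.specialUnitaryGroup (Fin n) ℂ))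
    (hΨ : ∀ V, Ψ (configConj n V) = configConj n (Ψ V))
    {J : GaugeConfig d L (Matrix.specialUnitaryGroup (Fin n) ℂ) → ℝ} (hJc : Continuous J) (hJ0 : ∀ U, 0 ≤ J U)
    (hJac : HasJacobian (Measure.pi fun _ : Edge d L => haarProbability (Matrix.specialUnitaryGroup (Fin n) ℂ)) Ψ
      (fun U => ENNReal.ofReal (J U)))
    {μ₀ : Measure (GaugeConfig d L (Matrix.specialUnitaryGroup (Fin n) ℂ))} (hμ₀ : μ₀.map (configConj n) = μ₀) (t : ℕ) :
    haveI : IsProbabilityMeasure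
        ((Measure.pi fun _ : Edge d L => haarProbability (Matrix.specialUnitaryGroup (Fin n) ℂ)).map Ψ) :=
      Measure.isProbabilityMeasure_map Ψ.measurable.aemeasurable
    (μ₀.bind (nHit (indepMH ((Measure.pi fun _ : Edge d L =>
          haarProbability (Matrix.specialUnitaryGroup (Fin n) ℂ)).map Ψ)
        (fun U => Real.exp (-β * wilsonAction ρ U) * J (Ψ.symm U))) t)).map (configConj n) =
      μ₀.bind (nHit (indepMH ((Measure.pi fun _ : Edge d L =>
          haarProbability (Matrix.specialUnitaryGroup (Fin n) ℂ)).map Ψ)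
        (fun U => Real.exp (-β * wilsonAction ρ U) * J (Ψ.symm U))) t) :=
  Scoring.map_bind_nHit_eq_self (conjKernel_wilsonFlowSampler_configConj ρ hρ hρC β Ψ hΨ hJc hJ0 hJac) hμ₀ t

/-- **`E_t[Im tr W(U)] = 0` at every step of the Wilson flow-sampler run** from any conjugation-invariant
start, for every `SU(N)`-valued field function with `W(Ū) = conj W(U)` (no integrability needed). -/
theorem integral_wilsonFlowSampler_im_trace_eq_zero {N : ℕ}
    (ρ : Matrix.specialUnitaryGroup (Fin n) ℂ →* Matrix (Fin N) (Fin N) ℂ) (hρ : Continuous ρ)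
    (hρC : ∀ g, (ρ (suConjAut n g)).trace.re = (ρ g).trace.re) (β : ℝ)
    (Ψ : GaugeConfig d L (Matrix.specialUnitaryGroup (Fin n) ℂ) ≃ᵐ GaugeConfig d L (Matrix.specialUnitaryGroup (Fin n) ℂ))
    (hΨ : ∀ V, Ψ (configConj n V) = configConj n (Ψ V))
    {J : GaugeConfig d L (Matrix.specialUnitaryGroup (Fin n) ℂ) → ℝ} (hJc : Continuous J) (hJ0 : ∀ U, 0 ≤ J U)
    (hJac : HasJacobian (Measure.pi fun _ : Edge d L => haarProbability (Matrix.specialUnitaryGroup (Fin n) ℂ)) Ψ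
      (fun U => ENNReal.ofReal (J U)))
    {μ₀ : Measure (GaugeConfig d L (Matrix.specialUnitaryGroup (Fin n) ℂ))} (hμ₀ : μ₀.map (configConj n) = μ₀) (t : ℕ)
    {W : GaugeConfig d L (Matrix.specialUnitaryGroup (Fin n) ℂ) → Matrix.specialUnitaryGroup (Fin n) ℂ}
    (hW : ∀ U, W (configConj n U) = suConjAut n (W U)) :
    haveI : IsProbabilityMeasure
        ((Measure.pi fun _ : Edge d L => haarProbability (Matrix.specialUnitaryGroup (Fin n) ℂ)).map Ψ) :=
      Measure.isProbabilityMeasure_map Ψ.measurable.aemeasurable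
    ∫ U, (fundamentalRep (Fin n) (W U)).trace.im ∂(μ₀.bind (nHit (indepMH ((Measure.pi fun _ : Edge d L =>
          haarProbability (Matrix.specialUnitaryGroup (Fin n) ℂ)).map Ψ)
        (fun U => Real.exp (-β * wilsonAction ρ U) * J (Ψ.symm U))) t)) = 0 :=
  integral_im_trace_eq_zero_of_map_configConj n
    (wilsonFlowSampler_law_map_configConj ρ hρ hρC β Ψ hΨ hJc hJ0 hJac hμ₀ t) hW

/-! ## §3 The `SU(N)` stout flow sampler of `SUNStoutFlowSamplerErgodic` -/

section Stout

variable {N : ℕ} (ρW : Matrix.specialUnitaryGroup (Fin n) ℂ →* Matrix (Fin N) (Fin N) ℂ) (hρW : Continuous ρW)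
  (hρWC : ∀ g, (ρW (suConjAut n g)).trace.re = (ρW g).trace.re) (β : ℝ)
  (p : Edge d L → Prop) [DecidablePred p]
  (ρ : GaugeConfig d L (Matrix.specialUnitaryGroup (Fin n) ℂ) → Edge d L → ℝ)
  (hρC : ∀ (V : GaugeConfig d L (Matrix.specialUnitaryGroup (Fin n) ℂ)) (e : Edge d L), p e →
    ρ (configConj n V) e = ρ V e)
  (Ψ : GaugeConfig d L (Matrix.specialUnitaryGroup (Fin n) ℂ) ≃ᵐ GaugeConfig d L (Matrix.specialUnitaryGroup (Fin n) ℂ))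
  (hΨ : ⇑Ψ = fun (V : GaugeConfig d L (Matrix.specialUnitaryGroup (Fin n) ℂ)) (e : Edge d L) =>
    if p e then
      (⟨NormedSpace.exp ((ρ V e : ℂ) • suProj (plaquetteLoopSum V e.1 e.2)),
          exp_smul_suProj_mem (ρ V e) (plaquetteLoopSum V e.1 e.2)⟩ :
        Matrix.specialUnitaryGroup (Fin n) ℂ) * V e
    else V e)
  {J : GaugeConfig d L (Matrix.specialUnitaryGroup (Fin n) ℂ) → ℝ} (hJc : Continuous J) (hJ0 : ∀ U, 0 ≤ J U)
  (hJac : HasJacobian (Measure.pi fun _ : Edge d L => haarProbability (Matrix.specialUnitaryGroup (Fin n) ℂ)) Ψ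
    (fun U => ENNReal.ofReal (J U)))

include hρW hρWC hρC hΨ hJc hJ0 hJac

/-- **The `SU(N)` stout-flow sampler for the Wilson action commutes with charge conjugation** (every
`N`, `d`, `L`; conjugation-even coefficient field; continuous exact Jacobian). -/
theorem conjKernel_stoutFlowSampler_configConj :
    haveI : IsProbabilityMeasure
        ((Measure.pi fun _ : Edge d L => haarProbability (Matrix.specialUnitaryGroup (Fin n) ℂ)).map Ψ) :=
      Measure.isProbabilityMeasure_map Ψ.measurable.aemeasurable
    conjKernel (indepMH ((Measure.pi fun _ : Edge d L =>
          haarProbability (Matrix.specialUnitaryGroup (Fin n) ℂ)).map Ψ)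
        (fun U => Real.exp (-β * wilsonAction ρW U) * J (Ψ.symm U))) (configConj n) =
      indepMH ((Measure.pi fun _ : Edge d L =>
          haarProbability (Matrix.specialUnitaryGroup (Fin n) ℂ)).map Ψ)
        (fun U => Real.exp (-β * wilsonAction ρW U) * J (Ψ.symm U)) :=
  conjKernel_wilsonFlowSampler_configConj ρW hρW hρWC β Ψ (sunStoutLayer_equiv_configConj p ρ hρC Ψ hΨ) hJc hJ0 hJac

/-- **Hot start: the law of the `SU(N)` stout-flow-sampler run is conjugation invariant at every step.** -/
theorem stoutFlowSampler_hotStart_law_map_configConj (t : ℕ) :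
    haveI : IsProbabilityMeasure
        ((Measure.pi fun _ : Edge d L => haarProbability (Matrix.specialUnitaryGroup (Fin n) ℂ)).map Ψ) :=
      Measure.isProbabilityMeasure_map Ψ.measurable.aemeasurable
    ((Measure.pi fun _ : Edge d L => haarProbability (Matrix.specialUnitaryGroup (Fin n) ℂ)).bind
        (nHit (indepMH ((Measure.pi fun _ : Edge d L =>
            haarProbability (Matrix.specialUnitaryGroup (Fin n) ℂ)).map Ψ)
          (fun U => Real.exp (-β * wilsonAction ρW U) * J (Ψ.symm U))) t)).map (configConj n) =
      (Measure.pi fun _ : Edge d L => haarProbability (Matrix.specialUnitaryGroup (Fin n) ℂ)).bind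
        (nHit (indepMH ((Measure.pi fun _ : Edge d L =>
            haarProbability (Matrix.specialUnitaryGroup (Fin n) ℂ)).map Ψ)
          (fun U => Real.exp (-β * wilsonAction ρW U) * J (Ψ.symm U))) t) :=
  wilsonFlowSampler_law_map_configConj ρW hρW hρWC β Ψ (sunStoutLayer_equiv_configConj p ρ hρC Ψ hΨ) hJc hJ0 hJac
    Scoring.piHaar_map_configConj t

/-- **Hot start: `E_t[Im tr U_P] = 0` for every plaquette at every step of the `SU(N)` stout-flow-sampler run.** -/
theorem integral_stoutFlowSampler_hotStart_im_trace_plaquette_eq_zero (t : ℕ) (x : Site d L) (i j : Fin d) :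
    haveI : IsProbabilityMeasure
        ((Measure.pi fun _ : Edge d L => haarProbability (Matrix.specialUnitaryGroup (Fin n) ℂ)).map Ψ) :=
      Measure.isProbabilityMeasure_map Ψ.measurable.aemeasurable
    ∫ U, (fundamentalRep (Fin n) (plaquetteHolonomy U x i j)).trace.im
      ∂((Measure.pi fun _ : Edge d L => haarProbability (Matrix.specialUnitaryGroup (Fin n) ℂ)).bind
        (nHit (indepMH ((Measure.pi fun _ : Edge d L =>
            haarProbability (Matrix.specialUnitaryGroup (Fin n) ℂ)).map Ψ)
          (fun U => Real.exp (-β * wilsonAction ρW U) * J (Ψ.symm U))) t)) = 0 :=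
  integral_wilsonFlowSampler_im_trace_eq_zero ρW hρW hρWC β Ψ (sunStoutLayer_equiv_configConj p ρ hρC Ψ hΨ)
    hJc hJ0 hJac Scoring.piHaar_map_configConj t (fun U => plaquetteHolonomy_configConj n U x i j)

/-- **Hot start: `E_t[Im tr P] = 0` for every straight line / Polyakov line at every step.** -/
theorem integral_stoutFlowSampler_hotStart_im_trace_lineHolonomy_eq_zero (t : ℕ) (k : Fin d) (m : ℕ) (y : Site d L) :
    haveI : IsProbabilityMeasure
        ((Measure.pi fun _ : Edge d L => haarProbability (Matrix.specialUnitaryGroup (Fin n) ℂ)).map Ψ) :=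
      Measure.isProbabilityMeasure_map Ψ.measurable.aemeasurable
    ∫ U, (fundamentalRep (Fin n) (lineHolonomy U k m y)).trace.im
      ∂((Measure.pi fun _ : Edge d L => haarProbability (Matrix.specialUnitaryGroup (Fin n) ℂ)).bind
        (nHit (indepMH ((Measure.pi fun _ : Edge d L =>
            haarProbability (Matrix.specialUnitaryGroup (Fin n) ℂ)).map Ψ)
          (fun U => Real.exp (-β * wilsonAction ρW U) * J (Ψ.symm U))) t)) = 0 :=
  integral_wilsonFlowSampler_im_trace_eq_zero ρW hρW hρWC β Ψ (sunStoutLayer_equiv_configConj p ρ hρC Ψ hΨ)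
    hJc hJ0 hJac Scoring.piHaar_map_configConj t (fun U => lineHolonomy_configConj n U k m y)

/-- **β-bootstrap / warm start: `E_t[Im tr U_P] = 0` at every step of the `SU(N)` stout-flow-sampler
run started from the Wilson measure at ANY coupling `β₀`** (`wilsonMeasure_map_configAut` supplies the
conjugation-invariant start). -/
theorem integral_stoutFlowSampler_wilsonStart_im_trace_plaquette_eq_zero (β₀ : ℝ) (t : ℕ) (x : Site d L)
    (i j : Fin d) :
    haveI : IsProbabilityMeasure
        ((Measure.pi fun _ : Edge d L => haarProbability (Matrix.specialUnitaryGroup (Fin n) ℂ)).map Ψ) :=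
      Measure.isProbabilityMeasure_map Ψ.measurable.aemeasurable
    ∫ U, (fundamentalRep (Fin n) (plaquetteHolonomy U x i j)).trace.im
      ∂((wilsonMeasure (d := d) (L := L) ρW β₀).bind
        (nHit (indepMH ((Measure.pi fun _ : Edge d L =>
            haarProbability (Matrix.specialUnitaryGroup (Fin n) ℂ)).map Ψ)
          (fun U => Real.exp (-β * wilsonAction ρW U) * J (Ψ.symm U))) t)) = 0 :=
  integral_wilsonFlowSampler_im_trace_eq_zero ρW hρW hρWC β Ψ (sunStoutLayer_equiv_configConj p ρ hρC Ψ hΨ)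
    hJc hJ0 hJac (wilsonMeasure_map_configAut (φ := suConjAut n) hρWC β₀) t
    (fun U => plaquetteHolonomy_configConj n U x i j)

end Stout

end Summit.Ventures.LatticeQCDFlow.Exactness

end
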